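import Mathlib
import HarnessLib
import Summits.NavierStokesRegularity.NavierStokesRegularity.Theorems.PoloidalWindowDoorLrcModEntireJetCertPsatzElimH

/-!
# Jet-certificate checker — STAGED replay for the economical content-removal variant (`…JetCertPsatzElimH`)

Cell `ns-wall-extremal`, arm C (PREREG-WALL-1 §C, C1a all-tilt cells), seat ns-wall-eng-6 g2 (Lean hands, crc-p1's pipeline), 2026-08-28.
`--supports stmt-NavierStokesRegularity-19708` (instrument).  Generic; no Navier–Stokes content.

WHY: a cell theorem `cell_kill` is ONE `native_decide` evaluation of `killCheckH` over the whole transcript; the gate gives an evaluation 600 s.  The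
all-tilt cell T1′(4,3) (149 laws, 150 788 terms, 262 steps) replays in ≈ 110 s in the Python mirror and — at the measured Lean/Python ratio ≈ 12 of the
list-polynomial arithmetic — needs ≈ 20 min in the kernel's native lane.  Here the SAME replay is cut into stages: a stage file proves by `native_decide`
that replaying a slice of the transcript from an explicit state `(hyps, pins)` lands on an explicit state `(hyps₁, pins₁)` (up to `polyEq`), the last
stage file runs `etreeCheckH` on the final slice, and `kills_of_stages` assembles the by-name statement `Kills n hyps pins [] [] J` — with the SAME
semantics as `kills_of_killCheckH` (every step's side conditions are the ones of `etreeCheckH`, verbatim).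

* `HStep` (a transcript step as data), `runH` (replay a list of steps: the `elim`/`force` branches of `etreeCheckH`, verbatim), `pointDatum_runH`
  (a real point of the input system is a real point of the output system);
* `polyListEq` (+ `pointDatum_of_polyListEq`), `stageCheckH` (+ **`pointDatum_of_stageCheckH`**);
* **`kills_of_stages`**: a chain `PointDatum (hyps, pins ++ [Σ X_j²]) → PointDatum (h_K, p_K)` + `etreeCheckH … h_K p_K [] [] t` ⇒ `Kills n hyps pins [] [] J`;
* self-test (`decide +kernel`): the toy transcript of `…JetCertPsatzElimH` cut into two stages.

WHAT THIS IS NOT: not a claim about Navier–Stokes, not a certificate. [folklore]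
-/

noncomputable section

-- the summit and its single sub-problem share the name (CONVENTIONS §1), as in every Theorems file
set_option linter.dupNamespace false

namespace Summit.NavierStokesRegularity.NavierStokesRegularity.Theorems.PoloidalWindowDoorLrcModEntireJetCertPsatzElimHStage

open _root_.Topology _root_.Filter Set
open Literature.Analysis.ValidatedNumerics Literature.Analysis.ValidatedNumerics.QMvPoly
open Literature.Analysis.Calculus.MvPoly
open Summit.NavierStokesRegularity.NavierStokesRegularity.Theorems.PoloidalWindowDoorLrcModEntireJetCertDefs
open Summit.NavierStokesRegularity.NavierStokesRegularity.Theorems.PoloidalWindowDoorLrcModEntireJetCertTree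
open Summit.NavierStokesRegularity.NavierStokesRegularity.Theorems.PoloidalWindowDoorLrcModEntireJetCertFast2
open Summit.NavierStokesRegularity.NavierStokesRegularity.Theorems.PoloidalWindowDoorLrcModEntireJetCertGauge
open Summit.NavierStokesRegularity.NavierStokesRegularity.Theorems.PoloidalWindowDoorLrcModEntireJetCertPsatz
open Summit.NavierStokesRegularity.NavierStokesRegularity.Theorems.PoloidalWindowDoorLrcModEntireJetCertPsatzSubst
open Summit.NavierStokesRegularity.NavierStokesRegularity.Theorems.PoloidalWindowDoorLrcModEntireJetCertPsatzElim
open Summit.NavierStokesRegularity.NavierStokesRegularity.Theorems.PoloidalWindowDoorLrcModEntireJetCertPsatzElimN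
open Summit.NavierStokesRegularity.NavierStokesRegularity.Theorems.PoloidalWindowDoorLrcModEntireJetCertPsatzElimG
open Summit.NavierStokesRegularity.NavierStokesRegularity.Theorems.PoloidalWindowDoorLrcModEntireJetCertPsatzElimH

variable {n : ℕ}

/-- One transcript step as plain data: `elim k i κ pe` (pivot law `k`, letter `i`, coefficient `κ · pins^pe`) or `force k j κ pe e`
(law `k` reads `κ · pins^pe · X_j^e`, so `X_j = 0` is adjoined). [folklore] -/
inductive HStep : Type
  | elim (k i : ℕ) (κ : ℚ) (pe : List ℕ)
  | force (k j : ℕ) (κ : ℚ) (pe : List ℕ) (e : ℕ)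

/-- **STAGED REPLAY**: run a list of steps from the state `(hyps, pins)` with exactly the side conditions and state updates of the `elim` / `force`
branches of `etreeCheckH` (gauge letters and sign conditions empty); `none` as soon as a side condition fails. [folklore] -/
def runH (n g : ℕ) : List HStep → List QMvPoly → List QMvPoly → Option (List QMvPoly × List QMvPoly)
  | [], hyps, pins => some (hyps, pins)
  | (.elim k i κ pe) :: rest, hyps, pins =>
      let L := hyps.getD k []
      let c := coeffIn i L
      let num := QMvPoly.smul (-1) (restIn i L)
      if decide (i < n) && decide (g < n) && hasVarPin n g pins && decide (κ ≠ 0) && decide (degIn i L ≤ 1) &&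
          polyEq c (QMvPoly.smul κ (pinProductN pins pe)) then
        runH n g rest (hyps.map (substStrip n g i num c)) (pins.map (substLawN i num c))
      else none
  | (.force k j κ pe e) :: rest, hyps, pins =>
      if decide (j < n) && decide (κ ≠ 0) && decide (1 ≤ e) &&
          polyEq (hyps.getD k []) (QMvPoly.smul κ (mulN (pinProductN pins pe) (powQN (QMvPoly.var n j) e))) then
        runH n g rest (hyps ++ [QMvPoly.var n j]) pins
      else none

/-- **SOUNDNESS OF THE STAGED REPLAY**: a real point of the input system (laws `= 0`, pins `≠ 0`) is a real point of the output system — the SAME point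
(each `elim` substitutes `c·X_i = num`, which holds at the point; each `force` adjoins `X_j = 0`, which holds at the point). [folklore] -/
theorem pointDatum_runH (g : ℕ) : ∀ (steps : List HStep) {hyps pins h' p' : List QMvPoly},
    runH n g steps hyps pins = some (h', p') → PointDatum n hyps pins [] [] → PointDatum n h' p' [] [] := by
  intro steps
  induction steps with
  | nil =>
    intro hyps pins h' p' h hd
    simp only [runH, Option.some.injEq, Prod.mk.injEq] at h
    obtain ⟨rfl, rfl⟩ := h
    exact hd
  | cons s rest ih =>
    intro hyps pins h' p' h hd
    cases s with
    | elim k i κ pe =>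
      simp only [runH] at h
      split_ifs at h with hc
      simp only [Bool.and_eq_true, decide_eq_true_eq] at hc
      obtain ⟨⟨⟨⟨⟨hi, hgn⟩, hvp⟩, hκ⟩, hdeg⟩, hcf⟩ := hc
      obtain ⟨z, hh, hp, hz, hq⟩ := hd
      set L := hyps.getD k [] with hL
      set c := coeffIn i L with hc_def
      set num := QMvPoly.smul (-1) (restIn i L) with hnum
      have hcz : ev n c z ≠ 0 := by
        rw [ev_eq_of_polyEq hcf z, ev_smul, ev_pinProductN]
        exact mul_ne_zero (by exact_mod_cast hκ) (ev_pinProduct_ne_zero z pins pe hp)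
      have hLz : ev n L z = 0 := ev_getD_eq_zero hh k
      have hlin := ev_linear_split z ⟨i, hi⟩ L hdeg
      have hzi : ev n c z * z ⟨i, hi⟩ = ev n num z := by
        rw [hnum, ev_smul]; push_cast
        have : z ⟨i, hi⟩ * ev n c z + ev n (restIn i L) z = 0 := by rw [← hLz, hlin]
        linarith
      have hzg : z ⟨g, hgn⟩ ≠ 0 := zg_ne_zero_of_hasVarPin (g := ⟨g, hgn⟩) hvp hp
      refine ih h ⟨z, ?_, ?_, hz, hq⟩
      · intro L' hL'
        obtain ⟨P, hP, rfl⟩ := List.mem_map.1 hL'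
        exact ev_substStrip_eq_zero z ⟨g, hgn⟩ ⟨i, hi⟩ num c hzg hzi (hh P hP)
      · intro π' hπ'
        obtain ⟨P, hP, rfl⟩ := List.mem_map.1 hπ'
        exact ev_substLawN_ne_zero z ⟨i, hi⟩ num c hzi hcz (hp P hP)
    | force k j κ pe e =>
      simp only [runH] at h
      split_ifs at h with hc
      simp only [Bool.and_eq_true, decide_eq_true_eq] at hc
      obtain ⟨⟨⟨hj, hκ⟩, he⟩, hform⟩ := hc
      obtain ⟨z, hh, hp, hz, hq⟩ := hd
      have hLz : ev n (hyps.getD k []) z = 0 := ev_getD_eq_zero hh k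
      rw [ev_eq_of_polyEq hform z, ev_smul, ev_mulN, ev_pinProductN, ev_powQN, ev_var z ⟨j, hj⟩] at hLz
      have hzj : z ⟨j, hj⟩ = 0 := by
        have h1 : (κ : ℝ) ≠ 0 := by exact_mod_cast hκ
        have h2 := ev_pinProduct_ne_zero z pins pe hp
        have h3 : z ⟨j, hj⟩ ^ e = 0 := by
          rcases mul_eq_zero.1 hLz with h | h
          · exact absurd h h1
          · rcases mul_eq_zero.1 h with h' | h'
            · exact absurd h' h2
            · exact h'
        exact pow_eq_zero_iff (by omega) |>.1 h3
      refine ih h ⟨z, ?_, hp, hz, hq⟩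
      intro L hL
      rcases List.mem_append.1 hL with hL' | hL'
      · exact hh L hL'
      · rw [List.mem_singleton.1 hL', ev_var z ⟨j, hj⟩]; exact hzj

/-- Two lists of polynomials agree term-by-term up to `polyEq` (same length). [folklore] -/
def polyListEq : List QMvPoly → List QMvPoly → Bool
  | [], [] => true
  | p :: ps, q :: qs => polyEq p q && polyListEq ps qs
  | _, _ => false

/-- `polyListEq` lists take the same values, member by member. [folklore] -/
theorem ev_mem_of_polyListEq : ∀ {a b : List QMvPoly}, polyListEq a b = true →
    ∀ (z : EuclideanSpace ℝ (Fin n)), ∀ q ∈ b, ∃ p ∈ a, ev n p z = ev n q z := by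
  intro a
  induction a with
  | nil =>
    intro b h z q hq
    cases b with
    | nil => simp at hq
    | cons _ _ => simp [polyListEq] at h
  | cons p ps ih =>
    intro b h z q hq
    cases b with
    | nil => simp [polyListEq] at h
    | cons q' qs =>
      simp only [polyListEq, Bool.and_eq_true] at h
      rcases List.mem_cons.1 hq with rfl | hq'
      · exact ⟨p, List.mem_cons_self .., ev_eq_of_polyEq h.1 z⟩
      · obtain ⟨p', hp', hev⟩ := ih h.2 z q hq'
        exact ⟨p', List.mem_cons_of_mem _ hp', hev⟩

/-- A real point of `(h, p)` is a real point of any `polyListEq` copy `(h₁, p₁)`. [folklore] -/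
theorem pointDatum_of_polyListEq {h p h₁ p₁ : List QMvPoly} (hh : polyListEq h h₁ = true) (hp : polyListEq p p₁ = true)
    (hd : PointDatum n h p [] []) : PointDatum n h₁ p₁ [] [] := by
  obtain ⟨z, hl, hπ, hz, hq⟩ := hd
  refine ⟨z, ?_, ?_, hz, hq⟩
  · intro L hL
    obtain ⟨P, hP, hev⟩ := ev_mem_of_polyListEq hh z L hL
    rw [← hev]; exact hl P hP
  · intro π hπ'
    obtain ⟨P, hP, hev⟩ := ev_mem_of_polyListEq hp z π hπ'
    rw [← hev]; exact hπ P hP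

/-- **STAGE CHECK** (Boolean): the steps replay from `(hyps, pins)` and land on `(h₁, p₁)` up to `polyEq`. [folklore] -/
def stageCheckH (n g : ℕ) (hyps pins : List QMvPoly) (steps : List HStep) (h₁ p₁ : List QMvPoly) : Bool :=
  match runH n g steps hyps pins with
  | none => false
  | some s => polyListEq s.1 h₁ && polyListEq s.2 p₁

/-- **SOUNDNESS OF A STAGE**: a real point of the stage's input system is a real point of its declared output system. [folklore] -/
theorem pointDatum_of_stageCheckH {g : ℕ} {hyps pins h₁ p₁ : List QMvPoly} {steps : List HStep}
    (h : stageCheckH n g hyps pins steps h₁ p₁ = true) (hd : PointDatum n hyps pins [] []) : PointDatum n h₁ p₁ [] [] := by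
  cases hr : runH n g steps hyps pins with
  | none => simp [stageCheckH, hr] at h
  | some s =>
    obtain ⟨s1, s2⟩ := s
    simp only [stageCheckH, hr, Bool.and_eq_true] at h
    exact pointDatum_of_polyListEq h.1 h.2 (pointDatum_runH g steps hr hd)

/-- **ASSEMBLY OF A STAGED KILL**: if every real point of `(hyps, pins ++ [Σ_{j∈J} X_j²])` is carried by the stages to a real point of `(h_K, p_K)`,
and the final transcript slice refutes `(h_K, p_K)`, then every real solution is untwisted — the statement of `kills_of_killCheckH`, by the same
argument. [folklore] -/
theorem kills_of_stages {g : ℕ} {hyps pins hK pK : List QMvPoly} {J : List ℕ} {t : ETree}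
    (hchain : PointDatum n hyps (pins ++ [sumSq n J]) [] [] → PointDatum n hK pK [] [])
    (ht : etreeCheckH n g hK pK [] [] t = true) : Kills n hyps pins [] [] J := by
  intro z hh hp hz hq j hjJ hj
  by_contra hne
  refine not_pointDatum_of_etreeCheckH g t ht (hchain ⟨z, hh, ?_, hz, hq⟩)
  intro π hπ
  rcases List.mem_append.1 hπ with h' | h'
  · exact hp π h'
  · rw [List.mem_singleton.1 h', ev_sumSq]
    have hnn : ∀ x ∈ J.map (fun j => ev n (QMvPoly.var n j) z * ev n (QMvPoly.var n j) z), (0 : ℝ) ≤ x := by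
      intro x hx
      obtain ⟨j', -, rfl⟩ := List.mem_map.1 hx
      exact mul_self_nonneg _
    have hmem : ev n (QMvPoly.var n j) z * ev n (QMvPoly.var n j) z ∈
        J.map (fun j => ev n (QMvPoly.var n j) z * ev n (QMvPoly.var n j) z) := List.mem_map.2 ⟨j, hjJ, rfl⟩
    have hle := List.single_le_sum hnn _ hmem
    have hpos : 0 < ev n (QMvPoly.var n j) z * ev n (QMvPoly.var n j) z := by
      rw [ev_var z ⟨j, hj⟩]; exact mul_self_pos.2 hne
    exact ne_of_gt (lt_of_lt_of_le hpos hle)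

/-! ### Self-test (`decide +kernel`): the toy transcript of `…JetCertPsatzElimH`, cut after its first step -/

/-- Stage 1 of the toy transcript: `elim 0 1 1 [1]` from the toy system lands on the declared state. [folklore] -/
theorem example_stage1 :
    stageCheckH 3 0 [[([1, 1, 0], (1 : ℚ)), ([0, 0, 0], (-1 : ℚ)), ([2, 0, 0], (-1 : ℚ))], [([0, 1, 1], (1 : ℚ)), ([1, 0, 1], (-1 : ℚ))]]
      [QMvPoly.var 3 0, sumSq 3 [2]] [.elim 0 1 1 [1]]
      [[], [([0, 0, 1], (1 : ℚ))]] [[([1, 0, 0], (1 : ℚ))], [([0, 0, 2], (1 : ℚ))]] = true := by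
  decide +kernel

/-- Stage 2 (final slice) of the toy transcript replays on the declared state. [folklore] -/
theorem example_stage2 :
    etreeCheckH 3 0 [[], [([0, 0, 1], (1 : ℚ))]] [[([1, 0, 0], (1 : ℚ))], [([0, 0, 2], (1 : ℚ))]] [] []
      (.force 1 2 1 [] 1 (.elim 2 2 1 [] (.leaf { steps := [], comb := [], e := [0, 1], sos0 := [], sosG := [] }))) = true := by
  decide +kernel

/-- The toy kill, assembled from the two stages — the same statement `example_killCheckH` certifies in one go. [folklore] -/
theorem example_kills_staged :
    Kills 3 [[([1, 1, 0], (1 : ℚ)), ([0, 0, 0], (-1 : ℚ)), ([2, 0, 0], (-1 : ℚ))], [([0, 1, 1], (1 : ℚ)), ([1, 0, 1], (-1 : ℚ))]]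
      [QMvPoly.var 3 0] [] [] [2] :=
  kills_of_stages (g := 0) (fun hd => pointDatum_of_stageCheckH example_stage1 hd) example_stage2

end Summit.NavierStokesRegularity.NavierStokesRegularity.Theorems.PoloidalWindowDoorLrcModEntireJetCertPsatzElimHStage

end
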